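import Summits.QuantumFields.YangMills.Theorems.UnitScaleTiltFluctuationComparisonRegPrApproxLiftGauge
import Literature.MathematicalPhysics.QuantumFieldTheory.Balaban1983to89.BlockAveragingSection
import Literature.MathematicalPhysics.QuantumFieldTheory.Balaban1983to89.B10StarCount

/-!
# Route `UnitScaleTilt` — crux K1bR-pr `FluctuationComparisonRegPr` (stmt-QuantumFields-19201), stub `stub_oneStepSmallLift`
# (W7 line), piece (L2-i): GAUGE COVARIANCE OF THE FACE SECTION and of face-section-based lifts (support file `--supports stmt-QuantumFields-19201`)

Cell `ym3-torus` (rung R3), seat `ym3-torus-p2` gen 8; CARD-19201-oneStepSmallLift-L1L2.md §2 (evidence on the item).  The approximate lift of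
the card is `U⋆ = (exp ζ) · faceSec V` with a covariantly defined `ζ`; all its estimates are done in a local gauge, which is legitimate because the
construction is COVARIANT.  This file records the covariance of the base:

* `blockOf_tgt_of_exits` / `blockOf_tgt_of_not_exits`: the block of the endpoint of a fine bond (from `B10StarCount.blockOf_shift`);
* `faceSec_gaugeAct`: `faceSec (V^g) = (faceSec V)^{g ∘ blockOf}` — the face section intertwines coarse gauge transformations with
  blockwise-constant fine ones;
* `mulLift_gaugeAct`: for a fine `E`, `((Ad_{g∘blockOf} E) · faceSec (V^g)) = (E · faceSec V)^{g ∘ blockOf}` bondwise, where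
  `(Ad_u E) b = u(b.src) E(b) u(b.src)⁻¹` — the lift `(exp ζ)·faceSec V` is covariant when `ζ` transforms by `Ad` at the source block.

Elementary; nothing of Bałaban's is asserted.
-/

noncomputable section

namespace Summit.QuantumFields.YangMills.Theorems.ApproxLift

open Literature.MathematicalPhysics.QuantumFieldTheory.Balaban1983to89
open Literature.MathematicalPhysics.QuantumFieldTheory.Balaban1983to89.BlockAveragingSection

variable {P : Params} {j : ℕ} {G : Type*} [GaugeGroup G]

/-- An exiting bond ends in the NEXT block: `blockOf b₊ = (blockOf b₋) + e_μ`. -/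
theorem blockOf_tgt_of_exits (hj : j + 1 ≤ P.m + P.K) {b : PBond P j} (h : ExitsBlock b) :
    blockOf b.tgt = (blockOf b.src).shift b.dir := by
  have hL := P.hL.2
  have h' : (b.src b.dir).val % P.L + 1 = P.L := by
    have : (b.src b.dir).val % P.L = P.L - 1 := h
    omega
  show blockOf (b.src.shift b.dir) = _
  rw [B10StarCount.blockOf_shift hj, if_pos h']

/-- A non-exiting bond stays in its block: `blockOf b₊ = blockOf b₋`. -/
theorem blockOf_tgt_of_not_exits (hj : j + 1 ≤ P.m + P.K) {b : PBond P j} (h : ¬ ExitsBlock b) :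
    blockOf b.tgt = blockOf b.src := by
  have hlt : (b.src b.dir).val % P.L < P.L := Nat.mod_lt _ P.L_pos
  have h' : ¬ ((b.src b.dir).val % P.L + 1 = P.L) := by
    intro h''
    exact h (show (b.src b.dir).val % P.L = P.L - 1 by omega)
  show blockOf (b.src.shift b.dir) = _
  rw [B10StarCount.blockOf_shift hj, if_neg h']

/-- **THE FACE SECTION IS GAUGE COVARIANT**: `faceSec (V^g) = (faceSec V)^{g ∘ blockOf}` (a coarse gauge transformation of the datum is a
blockwise-constant fine gauge transformation of the section). -/
theorem faceSec_gaugeAct (hj : j + 1 ≤ P.m + P.K) (g : GaugeTransf P (j + 1) G) (V : GaugeField P (j + 1) G) :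
    faceSec (GaugeField.gaugeAct g V) = GaugeField.gaugeAct (fun x => g (blockOf x)) (faceSec V) := by
  funext b
  by_cases h : ExitsBlock b
  · rw [faceSec_of_exits _ h]
    show g (blockOf b.src) * V ⟨blockOf b.src, b.dir⟩ * (g (PBond.tgt ⟨blockOf b.src, b.dir⟩))⁻¹ =
      g (blockOf b.src) * faceSec V b * (g (blockOf b.tgt))⁻¹
    rw [faceSec_of_exits V h, blockOf_tgt_of_exits hj h]
    rfl
  · rw [faceSec_of_not_exits _ h]
    show (1 : G) = g (blockOf b.src) * faceSec V b * (g (blockOf b.tgt))⁻¹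
    rw [faceSec_of_not_exits V h, blockOf_tgt_of_not_exits hj h, mul_one, mul_inv_cancel]

/-- The ADJOINT action of a fine gauge transformation at the SOURCE of each bond (how a covariantly defined Lie-algebra/bond correction
`E = exp ζ` transforms). -/
def adSrc (u : GaugeTransf P j G) (E : GaugeField P j G) : GaugeField P j G := fun b => u b.src * E b * (u b.src)⁻¹

/-- Evaluation of `adSrc`. -/
theorem adSrc_apply (u : GaugeTransf P j G) (E : GaugeField P j G) (b : PBond P j) : adSrc u E b = u b.src * E b * (u b.src)⁻¹ := rfl

/-- **COVARIANCE OF FACE-SECTION-BASED LIFTS**: with `u = g ∘ blockOf`, `(Ad_u E) · faceSec (V^g) = (E · faceSec V)^u` bondwise.  Hence a lift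
`(exp ζ_V) · faceSec V` with `ζ_{V^g} = Ad_{g∘blockOf} ζ_V` is a gauge transform of the lift of `V`, and all its plaquette sizes and (by
`BlockAveraging.avgFun_covariant`) the gauge class of its block average are those of the lift of `V`. -/
theorem mulLift_gaugeAct (hj : j + 1 ≤ P.m + P.K) (g : GaugeTransf P (j + 1) G) (V : GaugeField P (j + 1) G) (E : GaugeField P j G) :
    (fun b => adSrc (fun x => g (blockOf x)) E b * faceSec (GaugeField.gaugeAct g V) b) =
      GaugeField.gaugeAct (fun x => g (blockOf x)) (fun b => E b * faceSec V b) := by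
  funext b
  rw [faceSec_gaugeAct hj, adSrc_apply]
  show g (blockOf b.src) * E b * (g (blockOf b.src))⁻¹ * (g (blockOf b.src) * faceSec V b * (g (blockOf b.tgt))⁻¹) =
    g (blockOf b.src) * (E b * faceSec V b) * (g (blockOf b.tgt))⁻¹
  group

end Summit.QuantumFields.YangMills.Theorems.ApproxLift

end
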